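import Mathlib.Algebra.Group.Subgroup.Even
import Mathlib.NumberTheory.LegendreSymbol.QuadraticChar.Basic
import Literature.NumberTheory.QuadraticForms.QuadraticNormIndex
import Literature.NumberTheory.QuadraticForms.HilbertSymbolLocal
import HarnessLib

/-!
# Square classes and the local norm index at a non-dyadic place (O'Meara 63:9, 63:13a)

Topic `NumberTheory/QuadraticForms`; namespace `Literature`; all declarations fully proved.

For a number field `K` and a finite place `v` not above `2` (`2 ∉ v`), write
`K_v = v.adicCompletion K`, `𝒪_v`, `𝓀_v` (finite, of odd characteristic), `Δ ∈ 𝒪_vˣ` a unit of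
non-square residue and `ϖ` a uniformiser.

* `isSquare_or_isSquare_mul_of_isUnit` : a unit `u ∈ 𝒪_vˣ` is a square or `u Δ` is a square
  (two square classes of units: `𝓀_vˣ/𝓀_vˣ²` has order `2`, plus Hensel's lemma for squares).
* `exists_rep_mul_sq` : every `x ∈ K_vˣ` is `r c²` with `r ∈ {1, Δ⁻¹, ϖ, Δ⁻¹ ϖ}`; hence
  `finite_quotient_square` : `K_vˣ/K_vˣ²` is finite of order `≤ 4`, and in fact
  `index_square_eq_four` : **O'Meara 63:9** (non-dyadic case) `(K_vˣ : K_vˣ²) = 4`.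
* `index_quadraticNormSubgroup_eq_two` : **O'Meara 63:13a at a non-dyadic place** — for a
  non-square `a ∈ K_vˣ` the norm group `N_v(a) = quadraticNormSubgroup K_v a` of `K_v(√a)/K_v`
  has index `2` in `K_vˣ`: it contains the squares and a non-square (`-a`, or `Δ` when `-a` is a
  square), and misses some element (63:13,
  `adicCompletion_exists_hilbertSymbol_eq_neg_one_of_not_mem`),
  so `2 ≤ (K_vˣ : N_v(a))`, `2 ≤ (N_v(a) : K_vˣ²)` and `(K_vˣ : K_vˣ²) ≤ 4` force both indices to
  be `2`.
* `hilbertSymbol_mul_left` : consequently the Hilbert symbol at a non-dyadic place is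
  multiplicative, `(x y, a)_v = (x, a)_v (y, a)_v` (O'Meara §63B, the "fourth formula" of 57:10
  for the Hilbert symbol; at dyadic places this is the content of 63:13a there, not proved here).

These are the local index computations entering O'Meara's proof of the global norm index
theorem 65:21 (`normIdeles_index_eq_two`, via 65:8) at the non-dyadic places.

## References

* O. T. O'Meara, *Introduction to quadratic forms*, Grundlehren 117, Springer (1963), §63
  (63:9, 63:13, 63:13a; Example 63:12), §57 (57:10).
* J.-P. Serre, *A course in arithmetic*, GTM 7 (1973), Ch. II §3.3 Cor. (`ℚ_pˣ/ℚ_pˣ²` for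
  `p ≠ 2`) and Ch. III §1.2 Thm. 1 (bilinearity of the Hilbert symbol over `ℚ_p`).
-/

noncomputable section

open NumberField IsDedekindDomain Valued

namespace Literature.NumberTheory.QuadraticForms

variable (K : Type*) [Field K] [NumberField K] (v : HeightOneSpectrum (𝓞 K))

/-! ### Square classes of units -/

variable {K v} in
/-- A unit `t ∈ Fˣ` is a square in `Fˣ` iff it is a square in `F`. [folklore] -/
theorem isSquare_units_iff {F : Type*} [Field F] (t : Fˣ) : IsSquare t ↔ IsSquare (t : F) := by
  constructor
  · rintro ⟨s, hs⟩
    exact ⟨s, by rw [hs, Units.val_mul]⟩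
  · rintro ⟨s, hs⟩
    have hs0 : s ≠ 0 := by
      rintro rfl
      exact t.ne_zero (by rw [hs, mul_zero])
    exact ⟨Units.mk0 s hs0, Units.ext (by rw [Units.val_mul, Units.val_mk0, hs])⟩

/-- **Two square classes of units at a non-dyadic place**: if `2 ∈ 𝒪_vˣ`, `Δ ∈ 𝒪_v` has
non-square residue and `u ∈ 𝒪_vˣ`, then `u` or `u Δ` is a square in `𝒪_v` — the residue field
`𝓀_v` is finite of odd characteristic, so its quadratic character is multiplicative with values
`±1` on `𝓀_vˣ` (Mathlib `quadraticChar`), and squares lift by Hensel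
(`isSquare_of_isSquare_residue`). O'Meara 63:9 (units: `(𝔲 : 𝔲²) = 2` at non-dyadic `𝔭`).
[folklore] -/
theorem isSquare_or_isSquare_mul_of_isUnit (h2 : IsUnit (2 : 𝒪[v.adicCompletion K]))
    {Δ : 𝒪[v.adicCompletion K]} (hΔ : ¬ IsSquare (IsLocalRing.residue 𝒪[v.adicCompletion K] Δ))
    {u : 𝒪[v.adicCompletion K]} (hu : IsUnit u) : IsSquare u ∨ IsSquare (u * Δ) := by
  classical
  haveI := Literature.NumberTheory.Automorphic.finite_residueField_adicCompletion K v
  letI := Fintype.ofFinite 𝓀[v.adicCompletion K]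
  set ū := IsLocalRing.residue 𝒪[v.adicCompletion K] u with hū
  set δ := IsLocalRing.residue 𝒪[v.adicCompletion K] Δ with hδ
  have hres0 : ∀ {w : 𝒪[v.adicCompletion K]}, IsUnit w →
      IsLocalRing.residue 𝒪[v.adicCompletion K] w ≠ 0 := fun hw h0 ↦ by
    rw [IsLocalRing.residue_eq_zero_iff, IsLocalRing.mem_maximalIdeal, mem_nonunits_iff] at h0
    exact h0 hw
  have hΔu : IsUnit Δ := by
    by_contra h
    apply hΔ
    have h0 : δ = 0 := by
      rw [hδ, IsLocalRing.residue_eq_zero_iff, IsLocalRing.mem_maximalIdeal, mem_nonunits_iff]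
      exact h
    rw [h0]
    exact IsSquare.zero
  by_cases hsq : IsSquare ū
  · exact Or.inl (isSquare_of_isSquare_residue K v h2 hu hsq)
  · right
    refine isSquare_of_isSquare_residue K v h2 (hu.mul hΔu) ?_
    have hū1 : quadraticChar 𝓀[v.adicCompletion K] ū = -1 :=
      (quadraticChar_neg_one_iff_not_isSquare).2 hsq
    have hδ1 : quadraticChar 𝓀[v.adicCompletion K] δ = -1 :=
      (quadraticChar_neg_one_iff_not_isSquare).2 hΔ
    have hprod : quadraticChar 𝓀[v.adicCompletion K]
        (IsLocalRing.residue 𝒪[v.adicCompletion K] (u * Δ)) = 1 := by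
      have h : quadraticChar 𝓀[v.adicCompletion K]
          (IsLocalRing.residue 𝒪[v.adicCompletion K] (u * Δ)) = (-1) * (-1) := by
        rw [map_mul, map_mul, ← hū, ← hδ, hū1, hδ1]
      rw [h]
      norm_num
    have hne : IsLocalRing.residue 𝒪[v.adicCompletion K] (u * Δ) ≠ 0 := by
      rw [map_mul]
      exact mul_ne_zero (hres0 hu) (hres0 hΔu)
    exact (quadraticChar_one_iff_isSquare hne).1 hprod

/-! ### The four square classes of `K_vˣ` -/

/-- **Square classes at a non-dyadic place**: with `Δ` a unit of non-square residue and `ϖ` of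
valuation `exp(-1)` (a uniformiser), every `x ∈ K_vˣ` is `r c²` with
`r ∈ {1, Δ⁻¹, ϖ, Δ⁻¹ ϖ}`, encoded by two booleans. (Write `x = u ϖⁿ`; `u` or `u Δ` is a square,
and `ϖⁿ` is a square or `ϖ` times a square.) O'Meara 63:9; Serre, *Cours d'arithmétique*,
II §3.3. [folklore] -/
theorem exists_rep_mul_sq (h2 : IsUnit (2 : 𝒪[v.adicCompletion K]))
    {Δ : 𝒪[v.adicCompletion K]} (hΔ : ¬ IsSquare (IsLocalRing.residue 𝒪[v.adicCompletion K] Δ))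
    (hΔ0 : (Δ : v.adicCompletion K) ≠ 0) {ϖ : v.adicCompletion K} (hϖ0 : ϖ ≠ 0)
    (hϖ : Valued.v ϖ = WithZero.exp (-1)) (x : (v.adicCompletion K)ˣ) :
    ∃ (e o : Bool) (c : (v.adicCompletion K)ˣ),
      x = ((if e then (Units.mk0 (Δ : v.adicCompletion K) hΔ0)⁻¹ else 1) *
            (if o then Units.mk0 ϖ hϖ0 else 1)) * c ^ 2 := by
  have hvϖ : Valued.v ϖ ≠ 0 := (Valuation.ne_zero_iff Valued.v).2 hϖ0
  have hx0 : (x : v.adicCompletion K) ≠ 0 := x.ne_zero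
  have hvx : Valued.v (x : v.adicCompletion K) ≠ 0 := (Valuation.ne_zero_iff Valued.v).2 hx0
  -- `x = u ϖ^{-(log v x)}`-normalisation: `n := -log v(x)` so that `v(x ϖ^{... }) = 1`
  set n : ℤ := WithZero.log (Valued.v (x : v.adicCompletion K)) with hn
  -- parity of `n`
  rcases Int.even_or_odd n with ⟨m, hm⟩ | ⟨m, hm⟩
  · -- `n = 2m`: `u := x ϖ^{2m}` is a unit (`v(ϖ^{2m}) = exp(-2m)`, `v x = exp(2m)`)
    set u : v.adicCompletion K := x * ϖ ^ (m + m) with hudef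
    have hu1 : Valued.v u = 1 := by
      have hu0 : Valued.v u ≠ 0 := by
        rw [hudef, map_mul]; exact mul_ne_zero hvx (by rw [map_zpow₀]; exact zpow_ne_zero _ hvϖ)
      have hl : WithZero.log (Valued.v u) = 0 := by
        rw [hudef, map_mul, WithZero.log_mul hvx (by rw [map_zpow₀]; exact zpow_ne_zero _ hvϖ),
          map_zpow₀, WithZero.log_zpow, hϖ, WithZero.log_exp, ← hn, hm, smul_eq_mul]
        ring
      rw [← WithZero.exp_log hu0, hl, WithZero.exp_zero]
    let u' : 𝒪[v.adicCompletion K] := ⟨u, hu1.le⟩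
    have hu'u : IsUnit u' := (isUnit_integer_iff K v u').2 hu1
    rcases isSquare_or_isSquare_mul_of_isUnit K v h2 hΔ hu'u with ⟨s, hs⟩ | ⟨s, hs⟩
    · -- `u = s²`, so `x = s² ϖ^{-2m} = 1 · (s ϖ^{-m})²`
      have hs' : u = (s : v.adicCompletion K) * s := congr_arg Subtype.val hs
      have hs0 : (s : v.adicCompletion K) ≠ 0 := by
        intro h0
        rw [h0, mul_zero] at hs'
        rw [hs', map_zero] at hu1
        exact zero_ne_one hu1
      refine ⟨false, false, Units.mk0 ((s : v.adicCompletion K) * ϖ ^ (-m)) (mul_ne_zero hs0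
        (zpow_ne_zero _ hϖ0)), Units.ext ?_⟩
      simp only [Bool.false_eq_true, if_false, one_mul, Units.val_pow_eq_pow_val, Units.val_mk0]
      have hx : (x : v.adicCompletion K) = u * ϖ ^ (-(m + m)) := by
        rw [hudef, mul_assoc, ← zpow_add₀ hϖ0, add_neg_cancel, zpow_zero, mul_one]
      rw [hx, hs', show -(m + m) = -m + -m by ring, zpow_add₀ hϖ0]
      ring
    · -- `u Δ = s²`, so `x = Δ⁻¹ s² ϖ^{-2m} = Δ⁻¹ (s ϖ^{-m})²`
      have hs' : u * Δ = (s : v.adicCompletion K) * s := congr_arg Subtype.val hs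
      have hs0 : (s : v.adicCompletion K) ≠ 0 := by
        intro h0
        rw [h0, mul_zero] at hs'
        rcases mul_eq_zero.1 hs' with h | h
        · rw [h, map_zero] at hu1; exact zero_ne_one hu1
        · exact hΔ0 h
      refine ⟨true, false, Units.mk0 ((s : v.adicCompletion K) * ϖ ^ (-m)) (mul_ne_zero hs0
        (zpow_ne_zero _ hϖ0)), Units.ext ?_⟩
      simp only [if_true, Bool.false_eq_true, if_false, mul_one, Units.val_mul,
        Units.val_inv_eq_inv_val, Units.val_mk0, Units.val_pow_eq_pow_val]
      have hx : (x : v.adicCompletion K) = u * ϖ ^ (-(m + m)) := by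
        rw [hudef, mul_assoc, ← zpow_add₀ hϖ0, add_neg_cancel, zpow_zero, mul_one]
      have hu : u = (Δ : v.adicCompletion K)⁻¹ * (s * s) := by
        rw [← hs', mul_comm u, ← mul_assoc, inv_mul_cancel₀ hΔ0, one_mul]
      rw [hx, hu, show -(m + m) = -m + -m by ring, zpow_add₀ hϖ0]
      ring
  · -- `n = 2m + 1`: `u := x ϖ^{2m+1}` is a unit
    set u : v.adicCompletion K := x * ϖ ^ (m + m + 1) with hudef
    have hu1 : Valued.v u = 1 := by
      have hu0 : Valued.v u ≠ 0 := by
        rw [hudef, map_mul]; exact mul_ne_zero hvx (by rw [map_zpow₀]; exact zpow_ne_zero _ hvϖ)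
      have hl : WithZero.log (Valued.v u) = 0 := by
        rw [hudef, map_mul, WithZero.log_mul hvx (by rw [map_zpow₀]; exact zpow_ne_zero _ hvϖ),
          map_zpow₀, WithZero.log_zpow, hϖ, WithZero.log_exp, ← hn, hm, smul_eq_mul]
        ring
      rw [← WithZero.exp_log hu0, hl, WithZero.exp_zero]
    let u' : 𝒪[v.adicCompletion K] := ⟨u, hu1.le⟩
    have hu'u : IsUnit u' := (isUnit_integer_iff K v u').2 hu1
    have hx : (x : v.adicCompletion K) = u * ϖ * ϖ ^ (-(m + 1) + -(m + 1)) := by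
      rw [hudef, mul_assoc, mul_assoc, ← zpow_one_add₀ hϖ0, ← zpow_add₀ hϖ0,
        show m + m + 1 + (1 + (-(m + 1) + -(m + 1))) = 0 by ring, zpow_zero, mul_one]
    rcases isSquare_or_isSquare_mul_of_isUnit K v h2 hΔ hu'u with ⟨s, hs⟩ | ⟨s, hs⟩
    · have hs' : u = (s : v.adicCompletion K) * s := congr_arg Subtype.val hs
      have hs0 : (s : v.adicCompletion K) ≠ 0 := by
        intro h0
        rw [h0, mul_zero] at hs'
        rw [hs', map_zero] at hu1
        exact zero_ne_one hu1
      refine ⟨false, true, Units.mk0 ((s : v.adicCompletion K) * ϖ ^ (-(m + 1))) (mul_ne_zero hs0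
        (zpow_ne_zero _ hϖ0)), Units.ext ?_⟩
      simp only [Bool.false_eq_true, if_false, if_true, one_mul, Units.val_mul, Units.val_mk0,
        Units.val_pow_eq_pow_val]
      rw [hx, hs', zpow_add₀ hϖ0]
      ring
    · have hs' : u * Δ = (s : v.adicCompletion K) * s := congr_arg Subtype.val hs
      have hs0 : (s : v.adicCompletion K) ≠ 0 := by
        intro h0
        rw [h0, mul_zero] at hs'
        rcases mul_eq_zero.1 hs' with h | h
        · rw [h, map_zero] at hu1; exact zero_ne_one hu1
        · exact hΔ0 h
      refine ⟨true, true, Units.mk0 ((s : v.adicCompletion K) * ϖ ^ (-(m + 1))) (mul_ne_zero hs0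
        (zpow_ne_zero _ hϖ0)), Units.ext ?_⟩
      simp only [if_true, Units.val_mul, Units.val_inv_eq_inv_val, Units.val_mk0,
        Units.val_pow_eq_pow_val]
      have hu : u = (Δ : v.adicCompletion K)⁻¹ * (s * s) := by
        rw [← hs', mul_comm u, ← mul_assoc, inv_mul_cancel₀ hΔ0, one_mul]
      rw [hx, hu, zpow_add₀ hϖ0]
      ring

/-- At a non-dyadic place `v`, the group of square classes `K_vˣ/K_vˣ²` is finite of order at
most `4`: the classes of `1, Δ⁻¹, ϖ, Δ⁻¹ϖ` exhaust it (`exists_rep_mul_sq`). (O'Meara 63:9 gives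
the exact value `4`, see `index_square_eq_four`.) [folklore] -/
theorem finite_quotient_square (h2 : (2 : 𝓞 K) ∉ v.asIdeal) :
    Finite ((v.adicCompletion K)ˣ ⧸ Subgroup.square (v.adicCompletion K)ˣ) ∧
      (Subgroup.square (v.adicCompletion K)ˣ).index ≤ 4 := by
  obtain ⟨Δ, hΔ⟩ := exists_not_isSquare_residue K v h2
  have h2u := isUnit_two_integer_of_not_mem K v h2
  have hΔu : IsUnit Δ := by
    by_contra h
    apply hΔ
    have h0 : IsLocalRing.residue 𝒪[v.adicCompletion K] Δ = 0 := by
      rw [IsLocalRing.residue_eq_zero_iff, IsLocalRing.mem_maximalIdeal, mem_nonunits_iff]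
      exact h
    rw [h0]
    exact IsSquare.zero
  have hΔ0 : (Δ : v.adicCompletion K) ≠ 0 := by
    intro h0
    have h1 := (isUnit_integer_iff K v Δ).1 hΔu
    rw [h0, map_zero] at h1
    exact zero_ne_one h1
  obtain ⟨π, hπ⟩ := v.valuation_exists_uniformizer K
  have hϖ : Valued.v (algebraMap K (v.adicCompletion K) π) = WithZero.exp (-1) := by
    have hval : Valued.v (algebraMap K (v.adicCompletion K) π) = v.valuation K π :=
      HeightOneSpectrum.valuedAdicCompletion_eq_valuation' v π
    rw [hval, hπ]
  have hϖ0 : algebraMap K (v.adicCompletion K) π ≠ 0 := by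
    intro h; rw [h, map_zero] at hϖ; exact WithZero.coe_ne_zero hϖ.symm
  -- the surjection `Bool × Bool → K_vˣ/K_vˣ²`
  set S := Subgroup.square (v.adicCompletion K)ˣ with hS
  let rep : Bool × Bool → (v.adicCompletion K)ˣ := fun p ↦
    (if p.1 then (Units.mk0 (Δ : v.adicCompletion K) hΔ0)⁻¹ else 1) *
      (if p.2 then Units.mk0 (algebraMap K (v.adicCompletion K) π) hϖ0 else 1)
  have hsurj : Function.Surjective (fun p : Bool × Bool ↦ (QuotientGroup.mk (rep p) : _ ⧸ S)) := by
    intro q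
    obtain ⟨x, rfl⟩ := QuotientGroup.mk_surjective q
    obtain ⟨e, o, c, hx⟩ := exists_rep_mul_sq K v h2u hΔ hΔ0 hϖ0 hϖ x
    refine ⟨(e, o), ?_⟩
    rw [QuotientGroup.eq, hS, Subgroup.mem_square]
    refine ⟨c, ?_⟩
    rw [hx, ← sq]
    change (rep (e, o))⁻¹ * (rep (e, o) * c ^ 2) = c ^ 2
    rw [inv_mul_cancel_left]
  have hfin : Finite ((v.adicCompletion K)ˣ ⧸ S) := Finite.of_surjective _ hsurj
  refine ⟨hfin, ?_⟩
  rw [Subgroup.index_eq_card]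
  have h := Nat.card_le_card_of_surjective _ hsurj
  simpa using h

/-! ### The local norm index at a non-dyadic place -/

/-- **O'Meara 63:13a at a non-dyadic place: the local norm index is `2`.** Let `v ∤ 2` and let
`a ∈ K_vˣ` be a non-square. Then the norm group `N_v(a) = quadraticNormSubgroup K_v a` (norms
from `K_v(√a)`) has index `2` in `K_vˣ`: it contains all squares and a non-square class (`-a`, or
the unit `Δ` of non-square residue when `-a` is a square: `(Δ, -1)_v = 1` by
`hilbertSymbol_eq_one_of_isUnit`), it is not everything by 63:13
(`adicCompletion_exists_hilbertSymbol_eq_neg_one_of_not_mem`), and `(K_vˣ : K_vˣ²) ≤ 4`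
(`finite_quotient_square`). [cite: Omeara1963, §63B Cor. 63:13a] -/
theorem index_quadraticNormSubgroup_eq_two (h2 : (2 : 𝓞 K) ∉ v.asIdeal)
    {a : v.adicCompletion K} (ha0 : a ≠ 0) (ha : ¬ IsSquare a) :
    (quadraticNormSubgroup (v.adicCompletion K) a).index = 2 := by
  haveI : CharZero (v.adicCompletion K) :=
    charZero_of_injective_algebraMap (algebraMap K _).injective
  set N := quadraticNormSubgroup (v.adicCompletion K) a with hN
  set S := Subgroup.square (v.adicCompletion K)ˣ with hS
  obtain ⟨hfin, hS4⟩ := finite_quotient_square K v h2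
  have h2u := isUnit_two_integer_of_not_mem K v h2
  -- `S ≤ N`
  have hSN : S ≤ N := fun t ht ↦
    mem_quadraticNormSubgroup_of_isSquare a ((isSquare_units_iff t).1 (Subgroup.mem_square.1 ht))
  -- `N ≠ ⊤` (63:13)
  have hNtop : N ≠ ⊤ := by
    obtain ⟨α, hα0, hα⟩ := adicCompletion_exists_hilbertSymbol_eq_neg_one_of_not_mem K v h2 a ha0 ha
    have hαN :=
      (hilbertSymbol_eq_neg_one_iff_not_mem_quadraticNormSubgroup ha0 (Units.mk0 α hα0)).1 hα
    intro htop
    rw [hN] at htop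
    exact hαN (htop ▸ Subgroup.mem_top _)
  -- a non-square norm: `c₀ ∈ N`, `c₀ ∉ S`
  have hc₀ : ∃ c₀ : (v.adicCompletion K)ˣ, c₀ ∈ N ∧ c₀ ∉ S := by
    by_cases hna : IsSquare (-a)
    · -- `-a = c²`: the unit `Δ` of non-square residue is a norm
      obtain ⟨c, hc⟩ := hna
      obtain ⟨Δ, hΔ⟩ := exists_not_isSquare_residue K v h2
      have hΔu : IsUnit Δ := by
        by_contra h
        apply hΔ
        have h0 : IsLocalRing.residue 𝒪[v.adicCompletion K] Δ = 0 := by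
          rw [IsLocalRing.residue_eq_zero_iff, IsLocalRing.mem_maximalIdeal, mem_nonunits_iff]
          exact h
        rw [h0]
        exact IsSquare.zero
      have hΔ1 := (isUnit_integer_iff K v Δ).1 hΔu
      have hΔ0 : (Δ : v.adicCompletion K) ≠ 0 := by
        intro h0; rw [h0, map_zero] at hΔ1; exact zero_ne_one hΔ1
      -- `(Δ, -1)_v = 1`: `Δ x² - y² = 1`
      have hm1 : IsUnit (-1 : 𝒪[v.adicCompletion K]) := isUnit_one.neg
      have hsym := hilbertSymbol_eq_one_of_isUnit K v h2u hΔu hm1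
      obtain ⟨x, y, hxy⟩ := (hilbertSymbol_eq_one_iff _ _).1 hsym
      push_cast at hxy
      have hx0 : x ≠ 0 := by
        rintro rfl
        apply ha
        -- then `-y² = 1`, so `-1 = y²` is a square and `a = -c² = (y c)²`
        refine ⟨y * c, ?_⟩
        have h1 : (-1 : v.adicCompletion K) = y * y := by linear_combination hxy
        linear_combination -hc + c ^ 2 * h1
      have hc0 : c ≠ 0 := by
        rintro rfl
        apply ha0
        linear_combination -hc
      refine ⟨Units.mk0 _ hΔ0, ⟨x⁻¹, y * x⁻¹ * c⁻¹, ?_⟩, ?_⟩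
      · -- `Δ = (1/x)² - a (y/(x c))²`  (`-a = c²`, `Δ x² - y² = 1`)
        have ha' : a = -(c * c) := by linear_combination -hc
        have hcc : c * c⁻¹ = 1 := mul_inv_cancel₀ hc0
        have hxx : x * x⁻¹ = 1 := mul_inv_cancel₀ hx0
        rw [Units.val_mk0]
        calc x⁻¹ ^ 2 - a * (y * x⁻¹ * c⁻¹) ^ 2
            = x⁻¹ ^ 2 * (1 + y ^ 2 * (c * c⁻¹) ^ 2) := by rw [ha']; ring
          _ = x⁻¹ ^ 2 * ((Δ : v.adicCompletion K) * x ^ 2) := by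
              rw [hcc]; congr 1; linear_combination -hxy
          _ = (Δ : v.adicCompletion K) * (x * x⁻¹) ^ 2 := by ring
          _ = (Δ : v.adicCompletion K) := by rw [hxx]; ring
      · rw [hS, Subgroup.mem_square, isSquare_units_iff, Units.val_mk0]
        rintro ⟨s, hs⟩
        apply hΔ
        have hs0 : Valued.v s = 1 := by
          have h := congr_arg Valued.v hs
          rw [hΔ1, map_mul] at h
          have hvs : Valued.v s ≠ 0 := by
            intro h0; rw [h0, mul_zero] at h; exact one_ne_zero h
          have hl := congr_arg WithZero.log h
          rw [WithZero.log_one, WithZero.log_mul hvs hvs] at hl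
          rw [← WithZero.exp_log hvs, show WithZero.log (Valued.v s) = 0 by omega,
            WithZero.exp_zero]
        refine ⟨IsLocalRing.residue 𝒪[v.adicCompletion K] ⟨s, hs0.le⟩, ?_⟩
        rw [← map_mul]
        congr 1
        exact Subtype.ext hs
    · refine ⟨-Units.mk0 a ha0, ⟨0, 1, by simp⟩, ?_⟩
      rw [hS, Subgroup.mem_square, isSquare_units_iff]
      simpa using hna
  obtain ⟨c₀, hc₀N, hc₀S⟩ := hc₀
  -- index bookkeeping: `(S.relIndex N) * N.index = S.index ≤ 4`, both factors `≥ 2`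
  have hmul := Subgroup.relIndex_mul_index hSN
  haveI := hfin
  have hS0 : S.index ≠ 0 := Subgroup.index_ne_zero_of_finite
  have hN1 : N.index ≠ 1 := fun h ↦ hNtop (Subgroup.index_eq_one.1 h)
  have hr1 : S.relIndex N ≠ 1 := fun h ↦ hc₀S (Subgroup.relIndex_eq_one.1 h hc₀N)
  have hN0 : N.index ≠ 0 := fun h ↦ hS0 (by rw [← hmul, h, mul_zero])
  have hr0 : S.relIndex N ≠ 0 := fun h ↦ hS0 (by rw [← hmul, h, zero_mul])
  -- `r * i ≤ 4`, `r ≥ 2`, `i ≥ 2` ⇒ `i = 2`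
  have hi2 : 2 ≤ N.index := by omega
  have hr2 : 2 ≤ S.relIndex N := by omega
  have hle : S.relIndex N * N.index ≤ 4 := hmul ▸ hS4
  by_contra hne
  have hi3 : 3 ≤ N.index := by omega
  nlinarith

/-- **O'Meara 63:9 at a non-dyadic place**: `(K_vˣ : K_vˣ²) = 4` for `v ∤ 2` (the square classes
are exactly `1, Δ, ϖ, Δϖ`). From `index_quadraticNormSubgroup_eq_two` for the non-square unit
`Δ`: `(K_vˣ : K_vˣ²) = (K_vˣ : N_v(Δ)) (N_v(Δ) : K_vˣ²)` with both factors `2`.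
[cite: Omeara1963, §63B Prop. 63:9] -/
theorem index_square_eq_four (h2 : (2 : 𝓞 K) ∉ v.asIdeal) :
    (Subgroup.square (v.adicCompletion K)ˣ).index = 4 := by
  haveI : CharZero (v.adicCompletion K) :=
    charZero_of_injective_algebraMap (algebraMap K _).injective
  obtain ⟨hfin, hS4⟩ := finite_quotient_square K v h2
  obtain ⟨Δ, hΔ⟩ := exists_not_isSquare_residue K v h2
  have h2u := isUnit_two_integer_of_not_mem K v h2
  have hΔu : IsUnit Δ := by
    by_contra h
    apply hΔ
    have h0 : IsLocalRing.residue 𝒪[v.adicCompletion K] Δ = 0 := by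
      rw [IsLocalRing.residue_eq_zero_iff, IsLocalRing.mem_maximalIdeal, mem_nonunits_iff]
      exact h
    rw [h0]
    exact IsSquare.zero
  have hΔ1 := (isUnit_integer_iff K v Δ).1 hΔu
  have hΔ0 : (Δ : v.adicCompletion K) ≠ 0 := by
    intro h0; rw [h0, map_zero] at hΔ1; exact zero_ne_one hΔ1
  -- `Δ` is not a square in `K_v`
  have hΔsq : ¬ IsSquare (Δ : v.adicCompletion K) := by
    rintro ⟨s, hs⟩
    apply hΔ
    have hs0 : Valued.v s = 1 := by
      have h := congr_arg Valued.v hs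
      rw [hΔ1, map_mul] at h
      have hvs : Valued.v s ≠ 0 := by
        intro h0; rw [h0, mul_zero] at h; exact one_ne_zero h
      have hl := congr_arg WithZero.log h
      rw [WithZero.log_one, WithZero.log_mul hvs hvs] at hl
      rw [← WithZero.exp_log hvs, show WithZero.log (Valued.v s) = 0 by omega, WithZero.exp_zero]
    refine ⟨IsLocalRing.residue 𝒪[v.adicCompletion K] ⟨s, hs0.le⟩, ?_⟩
    rw [← map_mul]
    congr 1
    exact Subtype.ext hs
  set N := quadraticNormSubgroup (v.adicCompletion K) (Δ : v.adicCompletion K) with hN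
  set S := Subgroup.square (v.adicCompletion K)ˣ with hS
  have hN2 : N.index = 2 := index_quadraticNormSubgroup_eq_two K v h2 hΔ0 hΔsq
  have hSN : S ≤ N := fun t ht ↦
    mem_quadraticNormSubgroup_of_isSquare _ ((isSquare_units_iff t).1 (Subgroup.mem_square.1 ht))
  have hmul := Subgroup.relIndex_mul_index hSN
  rw [hN2] at hmul
  -- `S.relIndex N * 2 = S.index ≤ 4`; it remains to exclude `S.relIndex N = 1`, i.e. `S = N`:
  -- then `S` would have index `2`, but `Δ ∉ S`, `ϖ ∉ S` and `Δ ϖ ∉ S` (odd valuation), whereas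
  -- in index `2` the product of two non-members is a member.
  haveI := hfin
  have hS0 : S.index ≠ 0 := Subgroup.index_ne_zero_of_finite
  have hr1 : S.relIndex N ≠ 1 := by
    intro h
    have hNS : N ≤ S := Subgroup.relIndex_eq_one.1 h
    have hSeq : S = N := le_antisymm hSN hNS
    have hS2 : S.index = 2 := hSeq ▸ hN2
    obtain ⟨π, hπ⟩ := v.valuation_exists_uniformizer K
    set ϖ := algebraMap K (v.adicCompletion K) π with hϖdef
    have hϖ : Valued.v ϖ = WithZero.exp (-1) := by
      have hval : Valued.v (algebraMap K (v.adicCompletion K) π) = v.valuation K π :=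
        HeightOneSpectrum.valuedAdicCompletion_eq_valuation' v π
      rw [hϖdef, hval, hπ]
    have hϖ0 : ϖ ≠ 0 := by
      rintro h; rw [h, map_zero] at hϖ; exact WithZero.coe_ne_zero hϖ.symm
    -- odd valuation elements are not squares
    have hodd : ∀ z : v.adicCompletion K, Valued.v z = WithZero.exp (-1) → ¬ IsSquare z := by
      rintro z hz ⟨s, hs⟩
      have h := congr_arg Valued.v hs
      rw [hz, map_mul] at h
      have hvs : Valued.v s ≠ 0 := by
        intro h0; rw [h0, mul_zero] at h; exact WithZero.coe_ne_zero h
      have hl := congr_arg WithZero.log h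
      rw [WithZero.log_exp, WithZero.log_mul hvs hvs] at hl
      omega
    have hϖS : Units.mk0 ϖ hϖ0 ∉ S := by
      rw [hS, Subgroup.mem_square, isSquare_units_iff, Units.val_mk0]; exact hodd ϖ hϖ
    have hΔS : Units.mk0 (Δ : v.adicCompletion K) hΔ0 ∉ S := by
      rw [hS, Subgroup.mem_square, isSquare_units_iff, Units.val_mk0]; exact hΔsq
    have hΔϖ : Valued.v ((Δ : v.adicCompletion K) * ϖ) = WithZero.exp (-1) := by
      rw [map_mul, hΔ1, one_mul, hϖ]
    have hΔϖS : Units.mk0 (Δ : v.adicCompletion K) hΔ0 * Units.mk0 ϖ hϖ0 ∉ S := by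
      rw [hS, Subgroup.mem_square, isSquare_units_iff, Units.val_mul, Units.val_mk0, Units.val_mk0]
      exact hodd _ hΔϖ
    exact hΔϖS ((Subgroup.mul_mem_iff_of_index_two hS2).2 (iff_of_false hΔS hϖS))
  have hr0 : S.relIndex N ≠ 0 := fun h ↦ hS0 (by rw [← hmul, h, zero_mul])
  omega

/-- **The Hilbert symbol at a non-dyadic place is multiplicative**: for `v ∤ 2` and
`x y a ∈ K_vˣ`, `(x y, a)_v = (x, a)_v (y, a)_v` (O'Meara §63B: the formula
`(α, β)_𝔭 (α, γ)_𝔭 = (α, βγ)_𝔭`, from 57:10; here from the norm index `2`,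
`index_quadraticNormSubgroup_eq_two`: `x y` is a norm iff `x, y` are both norms or both
non-norms). The dyadic places (where this is the content of 63:13a) are not treated.
[cite: Omeara1963, §63B (formulas after 63:10)] -/
theorem hilbertSymbol_mul_left (h2 : (2 : 𝓞 K) ∉ v.asIdeal) {x y a : v.adicCompletion K}
    (hx : x ≠ 0) (hy : y ≠ 0) (ha : a ≠ 0) :
    hilbertSymbol (v.adicCompletion K) (x * y) a =
      hilbertSymbol (v.adicCompletion K) x a * hilbertSymbol (v.adicCompletion K) y a := by
  haveI : CharZero (v.adicCompletion K) :=
    charZero_of_injective_algebraMap (algebraMap K _).injective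
  by_cases hasq : IsSquare a
  · rw [hilbertSymbol_comm, hilbertSymbol_eq_one_of_isSquare hasq ha, hilbertSymbol_comm x,
      hilbertSymbol_eq_one_of_isSquare hasq ha, hilbertSymbol_comm y,
      hilbertSymbol_eq_one_of_isSquare hasq ha, one_mul]
  set N := quadraticNormSubgroup (v.adicCompletion K) a
  have hN2 := index_quadraticNormSubgroup_eq_two K v h2 ha hasq
  have key := Subgroup.mul_mem_iff_of_index_two hN2 (a := Units.mk0 x hx) (b := Units.mk0 y hy)
  have hxy : Units.mk0 x hx * Units.mk0 y hy = Units.mk0 (x * y) (mul_ne_zero hx hy) :=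
    Units.ext rfl
  rw [hxy] at key
  -- translate memberships into symbol values
  have ex := hilbertSymbol_eq_one_iff_mem_quadraticNormSubgroup ha (Units.mk0 x hx)
  have ey := hilbertSymbol_eq_one_iff_mem_quadraticNormSubgroup ha (Units.mk0 y hy)
  have exy := hilbertSymbol_eq_one_iff_mem_quadraticNormSubgroup ha (Units.mk0 (x * y)
    (mul_ne_zero hx hy))
  rw [Units.val_mk0] at ex ey exy
  have hiff : hilbertSymbol (v.adicCompletion K) (x * y) a = 1 ↔
      (hilbertSymbol (v.adicCompletion K) x a = 1 ↔
        hilbertSymbol (v.adicCompletion K) y a = 1) := by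
    rw [exy, ex, ey]
    exact key
  rcases hilbertSymbol_eq_one_or_eq_neg_one x a with h1 | h1 <;>
    rcases hilbertSymbol_eq_one_or_eq_neg_one y a with h3 | h3
  · rw [h1, h3, hiff.2 (by rw [h1, h3]), one_mul]
  · rw [h1, h3, (hilbertSymbol_ne_one_iff _ _).1 fun h ↦ by
      have := (hiff.1 h).1 h1; rw [h3] at this; exact absurd this (by decide)]
    norm_num
  · rw [h1, h3, (hilbertSymbol_ne_one_iff _ _).1 fun h ↦ by
      have := (hiff.1 h).2 h3; rw [h1] at this; exact absurd this (by decide)]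
    norm_num
  · rw [h1, h3, hiff.2 (by rw [h1, h3]), neg_mul, one_mul, neg_neg]

end Literature.NumberTheory.QuadraticForms
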